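import Mathlib
import Literature.Computability.Complexity.ACNegationNormalForm
import Literature.Computability.Complexity.ACRealizeConnectives
import Literature.Computability.MetaComplexity.MCSPGapAC0Localized
import Literature.Computability.MetaComplexity.OliveiraSanthanam2018.MCSPAverageCaseCircuitMagnification
import HarnessLib

/-!
# The typed worst-case K of census row R68 implies the threshold's worst-case shadow

Census row R68 of the hardness magnification gap census (host summit `PneNP`; continuation part
`MagnificationGapCensus/AverageCaseCircuits.lean`) asks for ZERO-ERROR average-case hardness of
`MCSP[n^c]` for the device classes `OliveiraSanthanam2018.acFns d M` — circuits over
`acBasis = {¬, ∧ₖ, ∨ₖ}` of `acDepth ≤ d` with at most `M N` gates OTHER THAN NEGATIONS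
(`sizeWith acWeight`).  Its printed worst-case K is typed (`chop_thm52_oracleFree`, CHOPRS
arXiv:1911.08297 §5.2.1 Thm. 52, oracle-free instance; corollary
`chop_thm52_oracleFree.MCSPSize_pow_not_mem_ACd`: `MCSP[n^c] ∉ AC⁰_d` for one `c` and every `d`) in
terms of `ACd d` / `DepthSizeClass`, where EVERY gate counts and a family must decide at EVERY
length.  The census docstring (`MagnificationGapCensus.known_R68_worstCase`) recorded the implication
"K ⇒ [T's worst-case shadow]" as NOT derivable in the tree for want of (a) a De Morgan normalisation
lemma and (b) a patching lemma (census gap item G33).  This file supplies both and PROVES the link: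

* (a) is `Complexity.Circuit.exists_nnf` (`ACNegationNormalForm.lean`): `size ≤ N + 2·sizeWith
  acWeight` up to rewriting, `acDepth` kept;
* (b) `mem_ACd_of_eventually_mem_acFns`: if the `2ⁿ`-slices of a language of truth tables are
  EVENTUALLY computed by `acFns d (p N)` devices (`p` a polynomial), the language is in
  `ACd (max d 2)` — normalise the devices (a), use a DNF (`exists_dnf_circuit_pow`, depth `2`,
  `≤ 2^N·(N+1)+1` gates) at the finitely many small power-of-two lengths and the constant `false`
  elsewhere, and collect the budget into the polynomial `X + 2p + B`;
* hence (`frequently_not_mem_acFns_of_not_mem_ACd`) `L ∉ ACd (max d 2)` gives, for every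
  polynomial budget, INFINITELY MANY `n` at which no `acFns d (p N)` device computes the `2ⁿ`-slice;
* for R68 (`chop_thm52_oracleFree.frequently_sliceFn_not_mem_acFns`, `.worstCaseShadow`): for
  K's constant `c`, EVERY `γ > 0`, every depth `d` and every `k`, infinitely often the `2ⁿ`-slice
  of `MCSP[n^c]` is computed by no `acFns d (k·⌈N^γ⌉ + k)` device — the conclusion of the census's
  `gap_R68_worstCase` at that `c` for ALL `γ` (the threshold T itself, zero-error solvers, remains
  the row's open content; verdict T-ONLY unchanged).

All statements are PROVED; the only named fact is the hypothesis `chop_thm52_oracleFree`.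
-/

namespace Literature.Computability.MetaComplexity

open Filter
open Literature.Computability.Complexity

/-! ### DNF at depth 2 with the crude bound `2^N·(N+1)+1` -/

/-- Every Boolean function on `n` bits is realised over `acBasis` with `acDepth ≤ 2` and at most
`2^n·(n+1)+1` gates (the `∨` of the minterms of its true points). [folklore] -/
theorem acReal_dnf_pow {n : ℕ} (g : (Fin n → Bool) → Bool) : ACReal g 2 (2 ^ n * (n + 1) + 1) := by
  classical
  have hmin : ∀ t : {a : Fin n → Bool // g a = true},
      ACReal (fun x : Fin n → Bool => decide (x = t.1)) 1 (n * 1 + 1) := by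
    intro t
    have h := acReal_forall_fintype fun k : Fin n => acReal_lit (ι := Fin n) k (t.1 k)
    refine (h.congr fun x => ?_).mono le_rfl (by simp)
    simp only [decide_eq_true_eq, decide_eq_decide]
    exact ⟨fun h => funext h, fun h k => by rw [h]⟩
  have hex := acReal_exists_fintype hmin
  refine (hex.congr fun x => ?_).mono le_rfl ?_
  · rw [Bool.eq_iff_iff]
    simp only [decide_eq_true_eq]
    exact ⟨fun ⟨t, ht⟩ => by rw [ht]; exact t.2, fun hx => ⟨⟨x, hx⟩, rfl⟩⟩
  · have hc : Fintype.card {a : Fin n → Bool // g a = true} ≤ 2 ^ n :=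
      (Fintype.card_subtype_le _).trans (by simp)
    have h2 : Fintype.card {a : Fin n → Bool // g a = true} * (n * 1 + 1) ≤ 2 ^ n * (n + 1) := by
      rw [mul_one]; exact Nat.mul_le_mul_right _ hc
    omega

/-- Circuit form of `acReal_dnf_pow`. [folklore] -/
theorem exists_dnf_circuit_pow {n : ℕ} (g : (Fin n → Bool) → Bool) :
    ∃ C : Circuit (Fin n), C.IsOver acBasis ∧ C.acDepth ≤ 2 ∧ C.size ≤ 2 ^ n * (n + 1) + 1 ∧
      ∀ x, C.eval x = g x :=
  (acReal_dnf_pow g).toCircuit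

/-! ### From eventual small `acFns` devices on the slices to an `AC⁰_d` family -/

/-- Per-length circuits (ALL gates counted): if the `2ⁿ`-slices of `L` (a language of words of
power-of-two lengths) are computed by `acFns d M` devices for `n ≥ n₀`, then at EVERY length `N` the
slice has an `acBasis` circuit of `acDepth ≤ max d 2` and `size ≤ N + 2·M N + 2^{2^{n₀}}·(2^{n₀}+1) + 1`
(normal form of the device; DNF below `2^{n₀}`; the constant `false` off the powers of two). [folklore] -/
theorem exists_circuit_sliceFn {L : Language Bool} (hL : ∀ w ∈ L, ∃ n, w.length = 2 ^ n)
    {d : ℕ} {M : ℕ → ℕ} {n₀ : ℕ}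
    (h : ∀ n ≥ n₀, ChenJinWilliams2020.sliceFn L (2 ^ n) ∈ OliveiraSanthanam2018.acFns d M (2 ^ n))
    (N : ℕ) :
    ∃ C : Circuit (Fin N), C.IsOver acBasis ∧ C.acDepth ≤ max d 2 ∧
      C.size ≤ N + 2 * M N + 2 ^ (2 ^ n₀) * (2 ^ n₀ + 1) + 1 ∧
      ∀ x, C.eval x = ChenJinWilliams2020.sliceFn L N x := by
  classical
  by_cases hpow : ∃ n, N = 2 ^ n
  · obtain ⟨n, rfl⟩ := hpow
    by_cases hn : n₀ ≤ n
    · obtain ⟨C, ⟨hB, hD, hS⟩, hC⟩ := h n hn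
      obtain ⟨C', hB', hsz, hdp, hev⟩ := C.exists_nnf_of_le hB hD hS
      refine ⟨C', hB', hdp.trans (max_le_max le_rfl one_le_two), hsz.trans (max_le ?_ ?_),
        fun x => by rw [hev, hC x]⟩
      · exact Nat.le_add_right_of_le (Nat.le_add_right _ _)
      · exact Nat.le_add_left 1 _
    · obtain ⟨C, hB, hD, hS, hev⟩ := exists_dnf_circuit_pow (ChenJinWilliams2020.sliceFn L (2 ^ n))
      refine ⟨C, hB, hD.trans (le_max_right _ _), hS.trans ?_, hev⟩
      have hlt : 2 ^ n ≤ 2 ^ n₀ := Nat.pow_le_pow_right (by norm_num) (by omega)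
      have h1 : 2 ^ (2 ^ n) ≤ 2 ^ (2 ^ n₀) := Nat.pow_le_pow_right (by norm_num) hlt
      have h2 : 2 ^ (2 ^ n) * (2 ^ n + 1) ≤ 2 ^ (2 ^ n₀) * (2 ^ n₀ + 1) :=
        Nat.mul_le_mul h1 (by omega)
      generalize 2 ^ (2 ^ n) * (2 ^ n + 1) = X at hS h2
      generalize 2 ^ (2 ^ n₀) * (2 ^ n₀ + 1) = Y at h2 ⊢
      generalize 2 ^ n = Z at ⊢
      omega
  · refine ⟨Circuit.const _ false, Circuit.const_isOver_acBasis false, ?_, ?_, fun x => ?_⟩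
    · rw [Circuit.acDepth_const]; exact le_trans one_le_two (le_max_right _ _)
    · rw [Circuit.size_const]; omega
    · have hx : List.ofFn x ∉ L := fun hmem => by
        obtain ⟨n, hn⟩ := hL _ hmem
        exact hpow ⟨n, by simpa using hn⟩
      rw [Circuit.eval_const]
      simp only [ChenJinWilliams2020.sliceFn, Set.boolIndicator]
      rw [if_neg]
      exact hx

/-- **Patching**: eventual `acFns d M` devices on the `2ⁿ`-slices give an everywhere-deciding
`acBasis` family of `acDepth ≤ max d 2` and size `≤ N + 2·M N + B` for a constant `B`. [folklore] -/
theorem mem_DepthSizeClass_of_eventually_mem_acFns {L : Language Bool}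
    (hL : ∀ w ∈ L, ∃ n, w.length = 2 ^ n) {d : ℕ} {M : ℕ → ℕ}
    (h : ∀ᶠ n : ℕ in atTop,
      ChenJinWilliams2020.sliceFn L (2 ^ n) ∈ OliveiraSanthanam2018.acFns d M (2 ^ n)) :
    ∃ B : ℕ, L ∈ DepthSizeClass acBasis (fun _ => max d 2) (fun N => N + 2 * M N + B) := by
  obtain ⟨n₀, hn₀⟩ := Filter.eventually_atTop.1 h
  refine ⟨2 ^ (2 ^ n₀) * (2 ^ n₀ + 1) + 1, ?_⟩
  choose C hC using exists_circuit_sliceFn hL hn₀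
  refine ⟨C, fun N => ⟨(hC N).1, (hC N).2.1, ?_⟩, fun x => ?_⟩
  · have := (hC N).2.2.1; omega
  · rw [(hC x.length).2.2.2]
    simp [ChenJinWilliams2020.sliceFn, List.ofFn_get]

/-- **(b) of census item G33**: eventual `acFns d (p N)` devices (`p` a polynomial) on the
`2ⁿ`-slices put the language into `ACd (max d 2)`. [folklore] -/
theorem mem_ACd_of_eventually_mem_acFns {L : Language Bool} (hL : ∀ w ∈ L, ∃ n, w.length = 2 ^ n)
    {d : ℕ} {p : Polynomial ℕ}
    (h : ∀ᶠ n : ℕ in atTop, ChenJinWilliams2020.sliceFn L (2 ^ n) ∈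
      OliveiraSanthanam2018.acFns d (fun N => p.eval N) (2 ^ n)) :
    L ∈ ACd (max d 2) := by
  obtain ⟨B, hB⟩ := mem_DepthSizeClass_of_eventually_mem_acFns hL h
  refine Set.mem_iUnion.2 ⟨Polynomial.X + 2 * p + Polynomial.C B, ?_⟩
  convert hB using 3
  simp

/-- **K-type worst-case lower bounds transfer to the threshold's devices, infinitely often**: if
`L ∉ ACd (max d 2)`, then for every polynomial budget `p` there are infinitely many `n` at which
no `acFns d (p N)` device computes the `2ⁿ`-slice of `L`. [folklore] -/
theorem frequently_not_mem_acFns_of_not_mem_ACd {L : Language Bool}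
    (hL : ∀ w ∈ L, ∃ n, w.length = 2 ^ n) {d : ℕ} (hK : L ∉ ACd (max d 2)) (p : Polynomial ℕ) :
    ∃ᶠ n : ℕ in atTop, ChenJinWilliams2020.sliceFn L (2 ^ n) ∉
      OliveiraSanthanam2018.acFns d (fun N => p.eval N) (2 ^ n) :=
  Filter.not_eventually.1 fun h => hK (mem_ACd_of_eventually_mem_acFns hL h)

/-! ### Row R68: the worst-case shadow from the typed K -/

/-- The words of `MCSP[s]` are truth tables, of power-of-two length. [folklore] -/
theorem MCSPSize_length_pow (s : ℕ → ℕ) : ∀ w ∈ MCSPSize s, ∃ n, w.length = 2 ^ n := by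
  rintro w ⟨n, f, rfl, -⟩
  exact ⟨n, length_truthTable f⟩

/-- **R68, K ⇒ worst-case shadow (polynomial budgets)**: from `chop_thm52_oracleFree`, for the
fact's constant `c`, every depth `d` and every polynomial budget `p`, infinitely often the
`2ⁿ`-slice of `MCSP[n^c]` is computed by no `acFns d (p N)` device (unbounded fan-in `∧/∨/¬`,
`acDepth ≤ d`, at most `p N` gates other than negations).
[cite: arXiv191108297, §5.2.1 Thm. 52 (thm:localize-MCSP-AC0)] -/
theorem chop_thm52_oracleFree.frequently_sliceFn_not_mem_acFns (hK : chop_thm52_oracleFree) :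
    ∃ c : ℕ, ∀ (d : ℕ) (p : Polynomial ℕ), ∃ᶠ n : ℕ in atTop,
      ChenJinWilliams2020.sliceFn (MCSPSize fun m => m ^ c) (2 ^ n) ∉
        OliveiraSanthanam2018.acFns d (fun N => p.eval N) (2 ^ n) := by
  obtain ⟨c, hc⟩ := hK.MCSPSize_pow_not_mem_ACd
  exact ⟨c, fun d p => frequently_not_mem_acFns_of_not_mem_ACd (MCSPSize_length_pow _) (hc _) p⟩

/-- `⌈N^γ⌉ ≤ N^{⌈γ⌉} + 1` for `γ > 0`. [folklore] -/
theorem powCeil_le_pow_ceil_succ {γ : ℝ} (hγ : 0 < γ) (N : ℕ) :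
    ChenJinWilliams2019.powCeil γ N ≤ N ^ ⌈γ⌉₊ + 1 := by
  unfold ChenJinWilliams2019.powCeil
  rcases Nat.eq_zero_or_pos N with rfl | hN
  · simp [Real.zero_rpow hγ.ne']
  · have h1 : (N : ℝ) ^ γ ≤ (N : ℝ) ^ (⌈γ⌉₊ : ℝ) :=
      Real.rpow_le_rpow_of_exponent_le (by exact_mod_cast hN) (Nat.le_ceil γ)
    rw [Real.rpow_natCast] at h1
    calc ⌈(N : ℝ) ^ γ⌉₊ ≤ ⌈((N ^ ⌈γ⌉₊ : ℕ) : ℝ)⌉₊ := Nat.ceil_mono (by exact_mod_cast h1)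
      _ = N ^ ⌈γ⌉₊ := Nat.ceil_natCast _
      _ ≤ N ^ ⌈γ⌉₊ + 1 := Nat.le_succ _

/-- The threshold budget `k·⌈N^γ⌉ + k` is below the polynomial `k·(N^{⌈γ⌉} + 1) + k`. [folklore] -/
theorem sublinearBound_le_eval {γ : ℝ} (hγ : 0 < γ) (k N : ℕ) :
    ChenJinWilliams2019.sublinearBound γ k N ≤
      (Polynomial.C k * (Polynomial.X ^ ⌈γ⌉₊ + 1) + Polynomial.C k).eval N := by
  have h := powCeil_le_pow_ceil_succ hγ N
  simp only [ChenJinWilliams2019.sublinearBound, Polynomial.eval_add, Polynomial.eval_mul,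
    Polynomial.eval_C, Polynomial.eval_pow, Polynomial.eval_X, Polynomial.eval_one]
  exact Nat.add_le_add_right (Nat.mul_le_mul_left k h) k

/-- **R68, K ⇒ the worst-case shadow of the threshold, for EVERY `γ`**: from
`chop_thm52_oracleFree`, for the fact's constant `c`, every `γ > 0`, every depth `d` and every `k`,
infinitely often the `2ⁿ`-slice of `MCSP[n^c]` is computed by no `acFns d (k·⌈N^γ⌉ + k)` device —
the conclusion of the census's `MagnificationGapCensus.gap_R68_worstCase` at this `c`, for all
`γ` at once (T's devices; worst case; the zero-error threshold itself is untouched).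
[cite: arXiv191108297, §5.2.1 Thm. 52 (thm:localize-MCSP-AC0)] -/
theorem chop_thm52_oracleFree.worstCaseShadow (hK : chop_thm52_oracleFree) :
    ∃ c : ℕ, ∀ γ : ℝ, 0 < γ → ∀ d k : ℕ, ∃ᶠ n : ℕ in atTop,
      ChenJinWilliams2020.sliceFn (MCSPSize fun m => m ^ c) (2 ^ n) ∉
        OliveiraSanthanam2018.acFns d (ChenJinWilliams2019.sublinearBound γ k) (2 ^ n) := by
  obtain ⟨c, hc⟩ := hK.frequently_sliceFn_not_mem_acFns
  refine ⟨c, fun γ hγ d k => ?_⟩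
  refine (hc d (Polynomial.C k * (Polynomial.X ^ ⌈γ⌉₊ + 1) + Polynomial.C k)).mono
    fun n hn hmem => hn ?_
  exact OliveiraSanthanam2018.acFns_mono le_rfl (sublinearBound_le_eval hγ k (2 ^ n)) hmem

end Literature.Computability.MetaComplexity
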